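import Summits.MatrixMultiplication.MatrixMultiplication.Theorems.SoloInformedTwistedMatchingsSylow
import HarnessLib

/-!
# Twisted matchings in abelian groups of bounded exponent: `|ι| ≤ 3 |S|^{1-δ(m)}`

Solo-informed seat (MatrixMultiplication), gen 101. Clause (c) of the seat's Theorem B″
(sharpest-statement §2y(8)) in the kernel, for ALL finite abelian hosts of bounded exponent:
`exists_expTwistedMatching_card_le` — for every `m ≥ 1` there is `δ = δ(m) > 0` such that for
every finite abelian group `S` with `g^m = 1`, every finite family of automorphism pairs
`(φ_s, ψ_s)` of `S` and every `(x_i, y_i, z_i)_{i ∈ ι}` with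
`(∃ s, x_i φ_s(y_j) ψ_s(z_l) = 1) ⟺ i = j = l`: `|ι| ≤ 3 |S|^{1-δ}`. Proof: primary decomposition
`S ≅ ∏_i ℤ/p_i^{e_i}` (Mathlib), the prime `q` with the largest primary component `A = S_q`
(`|A|^{ω(m)} ≥ |S|`), `S ≅ A × T` with `q ∤ |T|`, and `exists_coprimeTwistedMatching_card_le`.
With `realization_expTwisted_inducedMatching_card_le` (Cohn–Umans 2013, Def. 12 form): a
translation scheme `𝒮(S, M₀)` over ANY finite abelian group of exponent dividing `m`, whatever
`M₀ ≤ Aut S`, realizes `⟨n,n,n⟩` only if every induced matching of `supp ⟨n,n,n⟩` has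
`≤ 3|S|^{1-δ(m)}` elements, i.e. (Behrend) only if `|S| ≥ n^{(2-o(1))/(1-δ(m))}`.
References: CohnUmans2013 (arXiv:1207.6528) Def. 12, §5, Conj. 21;
BlasiakChurchCohnGrochowUmans2017 (arXiv:1712.02302) Thm. 3.11 (the untwisted statement).
-/

noncomputable section

open scoped BigOperators
open Finset Literature.Combinatorics.Additive Literature.Barriers.MatrixMultiplication

namespace Summit.MatrixMultiplication.MatrixMultiplication.Theorems.TwistedSliceRank

section Exponent

/-- In a trivial host a twisted matching has at most one element. [folklore] -/
theorem twistedMatching_card_le_one_of_subsingleton {S : Type*} [Group S] [Subsingleton S]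
    {σ : Type*} (φ ψ : σ → S ≃* S) {ι : Type*} [Fintype ι] (x y z : ι → S)
    (hmatch : ∀ i j l : ι, (∃ s : σ, x i * φ s (y j) * ψ s (z l) = 1) ↔ (i = j ∧ j = l)) :
    Fintype.card ι ≤ 1 := by
  by_contra h
  obtain ⟨i, j, hij⟩ := Fintype.exists_pair_of_one_lt_card (α := ι) (by omega)
  obtain ⟨s, -⟩ := (hmatch i i i).2 ⟨rfl, rfl⟩
  exact hij ((hmatch i j j).1 ⟨s, Subsingleton.elim _ _⟩).1

/-- **Twisted matchings in finite abelian groups of bounded exponent.** For every `m ≥ 1` there is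
`δ > 0` such that for every finite abelian group `S` with `g^m = 1` for all `g`, every finite family
of automorphism pairs `(φ_s, ψ_s)` and every family `(x_i, y_i, z_i)_{i ∈ ι}` with
`(∃ s, x_i · φ_s(y_j) · ψ_s(z_l) = 1) ⟺ i = j = l`: `|ι| ≤ 3 · |S|^{1-δ}`. [this work] -/
theorem exists_expTwistedMatching_card_le (m : ℕ) (hm : 0 < m) :
    ∃ δ : ℝ, 0 < δ ∧ ∀ (S : Type) [CommGroup S] [Fintype S] [DecidableEq S],
      (∀ g : S, g ^ m = 1) →
      ∀ (σ : Type) [Fintype σ] (φ ψ : σ → S ≃* S) (ι : Type) [Fintype ι] (x y z : ι → S),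
      (∀ i j l : ι, (∃ s : σ, x i * φ s (y j) * ψ s (z l) = 1) ↔ (i = j ∧ j = l)) →
      (Fintype.card ι : ℝ) ≤ 3 * (Fintype.card S : ℝ) ^ (1 - δ) := by
  classical
  -- per-prime constants
  have H : ∀ q : ℕ, q.Prime → ∃ δ : ℝ, 0 < δ ∧ ∀ (κ : Type) [Fintype κ] [DecidableEq κ]
      (n e : κ → ℕ) [∀ i, NeZero (n i)], (∀ i, n i = q ^ e i) → (∀ i, e i ≤ m) →
      ∀ (T : Type) [Group T] [Fintype T] [DecidableEq T], Nat.Coprime q (Fintype.card T) →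
      ∀ (S : Type) [Group S] [Fintype S] [DecidableEq S]
        (_eS : S ≃* (((i : κ) → Multiplicative (ZMod (n i))) × T))
        (σ : Type) [Fintype σ] (φ ψ : σ → S ≃* S) (ι : Type) [Fintype ι] (x y z : ι → S),
      (∀ i j l : ι, (∃ s : σ, x i * φ s (y j) * ψ s (z l) = 1) ↔ (i = j ∧ j = l)) →
      (Fintype.card ι : ℝ) ≤ 3 * (Fintype.card T : ℝ) *
        (Fintype.card ((i : κ) → Multiplicative (ZMod (n i))) : ℝ) ^ (1 - δ) :=
    fun q hq => by haveI := Fact.mk hq; exact exists_coprimeTwistedMatching_card_le q m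
  choose δf hδf0 hδf using H
  let g : ℕ → ℝ := fun q => if hq : q.Prime then min (δf q hq) 1 else 1
  have hg0 : ∀ q, 0 < g q := by
    intro q; simp only [g]; split_ifs with hq
    exacts [lt_min (hδf0 q hq) one_pos, one_pos]
  have hg1 : ∀ q, g q ≤ 1 := by
    intro q; simp only [g]; split_ifs with hq
    exacts [min_le_right _ _, le_rfl]
  set P : Finset ℕ := m.primeFactors with hP
  set δ : ℝ := (∏ q ∈ P, g q) / (P.card + 1) with hδ
  have hprod0 : 0 < ∏ q ∈ P, g q := Finset.prod_pos fun q _ => hg0 q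
  have hδ0 : 0 < δ := div_pos hprod0 (by positivity)
  have hδle : ∀ q ∈ P, (P.card : ℝ) * δ ≤ g q := by
    intro q hq
    have h1 : ∏ q' ∈ P, g q' ≤ g q := by
      rw [← Finset.mul_prod_erase P g hq]
      exact mul_le_of_le_one_right (hg0 q).le
        (Finset.prod_le_one (fun i _ => (hg0 i).le) fun i _ => hg1 i)
    have h2 : (P.card : ℝ) * δ = (P.card / (P.card + 1)) * ∏ q' ∈ P, g q' := by
      rw [hδ]; ring
    rw [h2]
    have h3 : (P.card : ℝ) / (P.card + 1) ≤ 1 := by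
      rw [div_le_one (by positivity)]; linarith
    calc (P.card : ℝ) / (P.card + 1) * ∏ q' ∈ P, g q' ≤ 1 * ∏ q' ∈ P, g q' := by gcongr
      _ ≤ g q := by rw [one_mul]; exact h1
  refine ⟨δ, hδ0, ?_⟩
  intro S _ _ _ hexpS σ _ φ ψ ι _ x y z hmatch
  -- primary decomposition `S ≃* ∏_i ℤ/p_i^{e_i}`
  obtain ⟨κ, _, pp, hpp, e, ⟨f⟩⟩ := AddCommGroup.equiv_directSum_zmod_of_finite (Additive S)
  haveI : ∀ i, NeZero (pp i ^ e i) := fun i => ⟨pow_ne_zero _ (hpp i).ne_zero⟩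
  let eS0 : S ≃* ((i : κ) → Multiplicative (ZMod (pp i ^ e i))) :=
    MulEquiv.toAdditive.symm <| f.trans <|
      (DirectSum.addEquivProd _).trans (MulEquiv.piMultiplicative _).toAdditiveRight
  -- `p_i^{e_i} ∣ m`
  have hdvd : ∀ i, pp i ^ e i ∣ m := by
    intro i
    refine (ZMod.natCast_eq_zero_iff _ _).1 ?_
    have h1 := hexpS (eS0.symm (Pi.mulSingle i (Multiplicative.ofAdd (1 : ZMod (pp i ^ e i)))))
    rw [← map_pow, eS0.symm.map_eq_one_iff, ← Pi.mulSingle_pow, ← ofAdd_nsmul, nsmul_eq_mul,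
      mul_one] at h1
    have h2 := congr_fun h1 i
    rw [Pi.mulSingle_eq_same, Pi.one_apply, ofAdd_eq_one] at h2
    exact h2
  have hem : ∀ i, e i ≤ m := fun i =>
    ((Nat.lt_pow_self (hpp i).one_lt).le.trans (Nat.le_of_dvd hm (hdvd i)))
  -- the trivial host
  by_cases htriv : ∀ i, e i = 0
  · haveI : Subsingleton S := by
      haveI : ∀ i, Subsingleton (Multiplicative (ZMod (pp i ^ e i))) := fun i => by
        rw [htriv i, pow_zero]
        exact Multiplicative.toAdd.injective.subsingleton
      exact eS0.toEquiv.subsingleton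
    have h1 : (Fintype.card ι : ℝ) ≤ 1 := by
      exact_mod_cast twistedMatching_card_le_one_of_subsingleton φ ψ x y z hmatch
    have h2 : Fintype.card S = 1 := Fintype.card_eq_one_iff.2 ⟨1, fun g => Subsingleton.elim _ _⟩
    rw [h2, Nat.cast_one, Real.one_rpow, mul_one]
    linarith
  obtain ⟨i₀, hi₀⟩ := not_forall.1 htriv
  -- primary components and the largest one
  let N : ℕ → ℕ := fun q => ∏ i ∈ Finset.univ.filter (fun i => pp i = q), pp i ^ e i
  have hN1 : ∀ q, 1 ≤ N q := fun q =>
    Nat.one_le_iff_ne_zero.2 (Finset.prod_ne_zero_iff.2 fun i _ => pow_ne_zero _ (hpp i).ne_zero)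
  let Q : Finset ℕ := Finset.univ.image pp
  obtain ⟨q₀, hq₀Q, hmax⟩ :=
    Finset.exists_max_image Q N ⟨pp i₀, Finset.mem_image_of_mem pp (Finset.mem_univ i₀)⟩
  have hjunk : ∀ q, q ∉ P → N q = 1 := by
    intro q hqP
    refine Finset.prod_eq_one fun i hi => ?_
    have hiq : pp i = q := (Finset.mem_filter.1 hi).2
    by_cases hei : e i = 0
    · rw [hei, pow_zero]
    · exfalso; apply hqP
      rw [hP, Nat.mem_primeFactors, ← hiq]
      exact ⟨hpp i, (dvd_pow_self _ hei).trans (hdvd i), hm.ne'⟩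
  have hq₀P : q₀ ∈ P := by
    by_contra hq
    have h1 : pp i₀ ^ e i₀ ≤ N (pp i₀) :=
      Finset.single_le_prod' (f := fun i => pp i ^ e i)
        (fun i _ => Nat.one_le_iff_ne_zero.2 (pow_ne_zero _ (hpp i).ne_zero))
        (Finset.mem_filter.2 ⟨Finset.mem_univ _, rfl⟩)
    have h2 : 1 < pp i₀ ^ e i₀ := Nat.one_lt_pow hi₀ (hpp i₀).one_lt
    have h3 := hmax (pp i₀) (Finset.mem_image_of_mem pp (Finset.mem_univ i₀))
    rw [hjunk q₀ hq] at h3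
    omega
  have hq₀ : q₀.Prime := Nat.prime_of_mem_primeFactors hq₀P
  -- `|S| = ∏ N q ≤ (N q₀)^{ω(m)}`
  have hcardS : Fintype.card S = ∏ i, pp i ^ e i := by
    rw [Fintype.card_congr eS0.toEquiv]
    simp only [Fintype.card_pi, Fintype.card_multiplicative, ZMod.card]
  have hcardS_le : Fintype.card S ≤ N q₀ ^ P.card := by
    rw [hcardS, ← Finset.prod_fiberwise_of_maps_to (s := Finset.univ) (t := Q) (g := pp)
      (fun i hi => Finset.mem_image_of_mem pp hi) (fun i => pp i ^ e i)]
    change ∏ q ∈ Q, N q ≤ N q₀ ^ P.card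
    rw [← Finset.prod_filter_mul_prod_filter_not Q (· ∈ P) N,
      Finset.prod_eq_one (s := Q.filter (fun q => ¬ q ∈ P))
        (fun q hq => hjunk q (Finset.mem_filter.1 hq).2), mul_one]
    calc ∏ q ∈ Q.filter (· ∈ P), N q ≤ N q₀ ^ (Q.filter (· ∈ P)).card :=
          Finset.prod_le_pow_card _ _ _ fun q hq => hmax q (Finset.mem_of_mem_filter q hq)
      _ ≤ N q₀ ^ P.card :=
          Nat.pow_le_pow_right (hN1 q₀) (Finset.card_le_card fun q hq => (Finset.mem_filter.1 hq).2)
  -- the splitting `S ≃* A × T` along the `q₀`-primary coordinates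
  let β : κ → Type := fun i => Multiplicative (ZMod (pp i ^ e i))
  let ePi : ((i : κ) → β i) ≃* (((i : {i // pp i = q₀}) → β i) × ((i : {i // ¬ pp i = q₀}) → β i)) :=
    { Equiv.piEquivPiSubtypeProd (fun i => pp i = q₀) β with map_mul' := fun _ _ => rfl }
  let eS := eS0.trans ePi
  have hcardA : Fintype.card ((i : {i // pp i = q₀}) → β i) = N q₀ := by
    simp only [β, Fintype.card_pi, Fintype.card_multiplicative, ZMod.card]
    exact (Finset.prod_subtype (p := fun i => pp i = q₀) (Finset.univ.filter (fun i => pp i = q₀))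
      (fun i => by simp only [Finset.mem_filter, Finset.mem_univ, true_and])
      (fun i => pp i ^ e i)).symm
  have hT : Nat.Coprime q₀ (Fintype.card ((i : {i // ¬ pp i = q₀}) → β i)) := by
    simp only [β, Fintype.card_pi, Fintype.card_multiplicative, ZMod.card]
    exact Nat.Coprime.prod_right fun i _ =>
      Nat.Coprime.pow_right _ ((Nat.coprime_primes hq₀ (hpp i.1)).2 (Ne.symm i.2))
  have hmain := hδf q₀ hq₀ {i // pp i = q₀} (fun i => pp i.1 ^ e i.1) (fun i => e i.1)
    (fun i => by rw [i.2]) (fun i => hem i.1) ((i : {i // ¬ pp i = q₀}) → β i) hT S eS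
    σ φ ψ ι x y z hmatch
  -- real bookkeeping
  have hST : Fintype.card S = Fintype.card ((i : {i // pp i = q₀}) → β i) *
      Fintype.card ((i : {i // ¬ pp i = q₀}) → β i) := by
    rw [Fintype.card_congr eS.toEquiv, Fintype.card_prod]
  set a : ℝ := (Fintype.card ((i : {i // pp i = q₀}) → β i) : ℝ) with ha
  set τ : ℝ := (Fintype.card ((i : {i // ¬ pp i = q₀}) → β i) : ℝ) with hτ
  have ha1 : 1 ≤ a := by rw [ha]; exact_mod_cast Fintype.card_pos
  have ha0 : 0 < a := by linarith
  have hS0 : 0 < (Fintype.card S : ℝ) := by exact_mod_cast Fintype.card_pos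
  have hSaτ : (Fintype.card S : ℝ) = a * τ := by rw [ha, hτ]; exact_mod_cast hST
  have hSa : (Fintype.card S : ℝ) ≤ a ^ P.card := by
    rw [ha, hcardA]; exact_mod_cast hcardS_le
  have hδA : (P.card : ℝ) * δ ≤ δf q₀ hq₀ := by
    have h1 := hδle q₀ hq₀P
    have h2 : g q₀ ≤ δf q₀ hq₀ := by simp only [g, dif_pos hq₀]; exact min_le_left _ _
    linarith
  have hpow : (Fintype.card S : ℝ) ^ δ ≤ a ^ δf q₀ hq₀ :=
    calc (Fintype.card S : ℝ) ^ δ ≤ (a ^ P.card) ^ δ := Real.rpow_le_rpow hS0.le hSa hδ0.le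
      _ = a ^ ((P.card : ℝ) * δ) := by rw [← Real.rpow_natCast, ← Real.rpow_mul ha0.le]
      _ ≤ a ^ δf q₀ hq₀ := Real.rpow_le_rpow_of_exponent_le ha1 hδA
  have hinv : 1 / a ^ δf q₀ hq₀ ≤ 1 / (Fintype.card S : ℝ) ^ δ :=
    one_div_le_one_div_of_le (Real.rpow_pos_of_pos hS0 _) hpow
  have hmain' : (Fintype.card ι : ℝ) ≤ 3 * τ * a ^ (1 - δf q₀ hq₀) := by
    simpa only [ha, hτ] using hmain
  calc (Fintype.card ι : ℝ) ≤ 3 * τ * a ^ (1 - δf q₀ hq₀) := hmain'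
    _ = 3 * (a * τ) * (1 / a ^ δf q₀ hq₀) := by
        rw [Real.rpow_sub ha0, Real.rpow_one]; ring
    _ ≤ 3 * (a * τ) * (1 / (Fintype.card S : ℝ) ^ δ) :=
        mul_le_mul_of_nonneg_left hinv (by positivity)
    _ = 3 * (Fintype.card S : ℝ) ^ (1 - δ) := by
        rw [← hSaτ, Real.rpow_sub hS0, Real.rpow_one]; ring

/-- **Realizations of `⟨n,n,n⟩` in translation schemes over abelian groups of bounded exponent have
small induced matchings** (Cohn–Umans 2013, Def. 12 form; the multiplier group is arbitrary).
[this work] -/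
theorem realization_expTwisted_inducedMatching_card_le (m : ℕ) (hm : 0 < m) :
    ∃ δ : ℝ, 0 < δ ∧ ∀ (S : Type) [CommGroup S] [Fintype S] [DecidableEq S],
      (∀ g : S, g ^ m = 1) →
      ∀ (σ : Type) [Fintype σ] (φ ψ : σ → S ≃* S) (n : ℕ) (α β γ : Fin n × Fin n → S),
      (∀ x y z : Fin n × Fin n, (∃ s : σ, α x * φ s (β y) * ψ s (γ z) = 1) ↔
          (y.1 = x.2 ∧ z = (y.2, x.1))) →
      ∀ (ι : Type) [Fintype ι] (a b c : ι → Fin n),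
        (∀ i j l : ι, b j = b i → c l = c j → a l = a i → i = j ∧ j = l) →
        (Fintype.card ι : ℝ) ≤ 3 * (Fintype.card S : ℝ) ^ (1 - δ) := by
  obtain ⟨δ, hδ0, hmain⟩ := exists_expTwistedMatching_card_le m hm
  refine ⟨δ, hδ0, fun S _ _ _ hexpS σ _ φ ψ n α β γ hreal ι _ a b c hind => ?_⟩
  refine hmain S hexpS σ φ ψ ι (fun i => α (a i, b i)) (fun j => β (b j, c j))
    (fun l => γ (c l, a l)) fun i j l => ?_
  rw [hreal (a i, b i) (b j, c j) (c l, a l)]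
  constructor
  · rintro ⟨h1, h2⟩
    simp only [Prod.mk.injEq] at h2
    exact hind i j l h1 h2.1 h2.2
  · rintro ⟨rfl, rfl⟩
    exact ⟨rfl, rfl⟩

end Exponent

end Summit.MatrixMultiplication.MatrixMultiplication.Theorems.TwistedSliceRank
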